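import Mathlib
import HarnessLib
import Summits.NavierStokesRegularity.NavierStokesRegularity.Theorems.TypeIQuarterGateScarEnvelopeTypeIForcedTsaiStokesletSelfAdvection

/-!
# ARM B — DATUM B-2k, kernel face of «R(εU₁) = ∞»: NO registered witness has an exact Stokeslet tail
  (ns-wall-extremal, eng-1 lineage g5, 2026-08-29)

WHAT IS PROVED (theorem-only; standard axioms).  `U_e(y) = (‖y‖²)^{−1/2} • e + ((‖y‖²)^{−3/2}⟪e,y⟫) • y`
is the Stokeslet of `…ForcedTsaiStokesletTail` (p691545); its registered vorticity residual is
`g_e(y) = −12⟪e,y⟫(‖y‖²)^{−3}(e × y)` (`lerayVorticityResidual_stokeslet`, `…StokesletSelfAdvection`).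
* `lerayVorticityResidual_congr` : the registered residual `curl(−ΔU + ½U + ½DU·y + (U·∇)U)` of
  `…ForcedTsaiDefs` is LOCAL (fields agreeing near `y` have the same residual at `y`);
* `norm_lerayVorticityResidual_stokeslet_ge` : on the open cone
  `S_e = {‖e‖‖y‖ < 2⟪e,y⟫, ‖e‖‖y‖ < 2‖e × y‖}` (i.e. `30° < ∠(e,y) < 60°`), `‖g_e(y)‖ ≥ 3‖e‖²/‖y‖⁴`;
  the cone is open, dilation invariant and non-empty for `e ≠ 0` (`isOpen_stokesletCone`,
  `smul_mem_stokesletCone_iff`, `stokesletCone_nonempty`), and its dyadic shells are dilates of the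
  first one (`stokesletCone_shell_eq_smul`);
* ★★ `not_integrable_residual_of_stokesletTail` : if `U : ℝ³ → ℝ³` COINCIDES WITH `U_e` (`e ≠ 0`)
  OUTSIDE SOME BALL, then `y ↦ (1+‖y‖)⁵‖g_U(y)‖²` is NOT integrable — on the `k`-th dyadic shell of the
  cone the density is `≥ 9‖e‖⁴/(2^{k+1}ρ)³` while the shell has volume `8^k·vol(shell₀) > 0`, so every
  shell carries the same positive mass and `∫⁻ = ∞`, contradicting `Integrable.lintegral_lt_top`;
* `not_forcedTsaiWitness_of_stokesletTail` : hence such a `U` never satisfies the witness clause of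
  `ForcedTsaiModulusLE M δ` (smooth ∧ div-free ∧ level ∧ INTEGRABLE weighted residual ∧ bound), for
  any `M`, `δ` and whatever its core.

MEANING (HOME/ARM-B/secondorder-eng1g5/SECOND-ORDER.md §3): the exact Type-I tail of the linear floor
mode (DATUM B-2j: `ω = c(y×e)/|y|³`, `U = (c/2)U_e = U_{(c/2)e}`) is admissible in the registered
currency at LINEAR order only; at any non-zero amplitude the registered residual is infinite unless
the tail is corrected at order `c²` (the `r⁻³` closure of the LANEX rows / the Landau direction,
memo §4).  A statement about the CURRENCY, not about profiles: it excludes no near-profile with a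
corrected tail, bounds no modulus, and says nothing about Navier–Stokes regularity.  Crux
`ScarEnvelopeTypeI` (stmt-23843) / wall H3 OPEN.
-/

noncomputable section

set_option linter.dupNamespace false

namespace Summit.NavierStokesRegularity.NavierStokesRegularity.Cruxes.ScarEnvelopeTypeI.ForcedTsai

open scoped Laplacian RealInnerProductSpace InnerProductSpace Pointwise
open Literature.Analysis.FluidPDE Set Filter Topology MeasureTheory

/-! ## Locality of the registered residual -/

/-- The registered vorticity residual is a LOCAL operator: fields that agree near `y` have the same
residual at `y`. -/
theorem lerayVorticityResidual_congr {U V : E3 → E3} {y : E3} (h : U =ᶠ[𝓝 y] V) :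
    lerayVorticityResidual U y = lerayVorticityResidual V y := by
  have hm : lerayMomentumResidual U =ᶠ[𝓝 y] lerayMomentumResidual V := by
    filter_upwards [h.eventuallyEq_nhds] with z hz
    rw [lerayMomentumResidual, lerayMomentumResidual, convect, convect,
      (InnerProductSpace.laplacian_congr_nhds hz).eq_of_nhds, hz.fderiv_eq, hz.eq_of_nhds]
  rw [lerayVorticityResidual, lerayVorticityResidual, curl_eq_curlCLM, curl_eq_curlCLM, hm.fderiv_eq]

/-! ## The double cone on which the Stokeslet residual is bounded below -/

/-- The open double-angle cone `30° < ∠(e, y) < 60°` (written without angles):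
`‖e‖‖y‖ < 2⟪e,y⟫` and `‖e‖‖y‖ < 2‖e × y‖`. -/
theorem isOpen_stokesletCone (e : E3) :
    IsOpen {y : E3 | ‖e‖ * ‖y‖ < 2 * ⟪e, y⟫ ∧ ‖e‖ * ‖y‖ < 2 * ‖cross e y‖} := by
  have hc : Continuous fun y : E3 => cross e y := (crossCLM e).continuous
  have h1 : IsOpen {y : E3 | ‖e‖ * ‖y‖ < 2 * ⟪e, y⟫} :=
    isOpen_lt (continuous_const.mul continuous_norm)
      (continuous_const.mul (continuous_const.inner continuous_id))
  have h2 : IsOpen {y : E3 | ‖e‖ * ‖y‖ < 2 * ‖cross e y‖} :=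
    isOpen_lt (continuous_const.mul continuous_norm) (continuous_const.mul hc.norm)
  exact h1.inter h2

/-- The cone is invariant under positive dilations. -/
theorem smul_mem_stokesletCone_iff (e : E3) {t : ℝ} (ht : 0 < t) (y : E3) :
    t • y ∈ {y : E3 | ‖e‖ * ‖y‖ < 2 * ⟪e, y⟫ ∧ ‖e‖ * ‖y‖ < 2 * ‖cross e y‖}
      ↔ y ∈ {y : E3 | ‖e‖ * ‖y‖ < 2 * ⟪e, y⟫ ∧ ‖e‖ * ‖y‖ < 2 * ‖cross e y‖} := by
  have hc : cross e (t • y) = t • cross e y := by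
    rw [← crossCLM_apply, map_smul, crossCLM_apply]
  simp only [mem_setOf_eq, norm_smul, Real.norm_eq_abs, abs_of_pos ht, inner_smul_right, hc]
  constructor
  · rintro ⟨h1, h2⟩
    constructor <;> nlinarith
  · rintro ⟨h1, h2⟩
    constructor <;> nlinarith

/-- On the cone (off the origin) the Stokeslet residual has size at least `3‖e‖²/‖y‖⁴`. -/
theorem norm_lerayVorticityResidual_stokeslet_ge (e : E3) {y : E3} (hy : y ≠ 0)
    (hc : ‖e‖ * ‖y‖ < 2 * ⟪e, y⟫ ∧ ‖e‖ * ‖y‖ < 2 * ‖cross e y‖) :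
    3 * ‖e‖ ^ 2 * (‖y‖⁻¹) ^ 4 ≤ ‖lerayVorticityResidual
        (fun z : E3 => (‖z‖ ^ 2) ^ (-(1 : ℝ) / 2) • e + ((‖z‖ ^ 2) ^ (-(3 : ℝ) / 2) * ⟪e, z⟫) • z) y‖ := by
  have hr : 0 < ‖y‖ := norm_pos_iff.mpr hy
  have e6 : (‖y‖ ^ 2) ^ (-(3 : ℝ)) = (‖y‖⁻¹) ^ 6 := norm_sq_rpow_eq_inv_pow hy (by norm_num)
  have h1 : 0 < ⟪e, y⟫ := by nlinarith [norm_nonneg e, hc.1]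
  rw [lerayVorticityResidual_stokeslet e hy, e6, norm_smul, Real.norm_eq_abs,
    show -12 * ⟪e, y⟫ * (‖y‖⁻¹) ^ 6 = -(12 * ⟪e, y⟫ * (‖y‖⁻¹) ^ 6) by ring, abs_neg,
    abs_of_pos (by positivity)]
  have hi : 0 < (‖y‖⁻¹) := inv_pos.mpr hr
  have hA : ‖e‖ * ‖y‖ * ‖y‖⁻¹ ≤ 2 * ⟪e, y⟫ * ‖y‖⁻¹ :=
    mul_le_mul_of_nonneg_right hc.1.le hi.le
  have hB : ‖e‖ * ‖y‖ * ‖y‖⁻¹ ≤ 2 * ‖cross e y‖ * ‖y‖⁻¹ :=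
    mul_le_mul_of_nonneg_right hc.2.le hi.le
  rw [mul_assoc, mul_inv_cancel₀ hr.ne', mul_one] at hA hB
  -- `3‖e‖² r⁻⁴ ≤ 12 ⟪e,y⟫ r⁻⁶ ‖e×y‖` from `‖e‖ ≤ 2⟪e,y⟫ r⁻¹` and `‖e‖ ≤ 2‖e×y‖ r⁻¹`
  calc 3 * ‖e‖ ^ 2 * (‖y‖⁻¹) ^ 4
      = 3 * (‖e‖ * ‖e‖) * (‖y‖⁻¹) ^ 4 := by ring
    _ ≤ 3 * ((2 * ⟪e, y⟫ * ‖y‖⁻¹) * (2 * ‖cross e y‖ * ‖y‖⁻¹)) * (‖y‖⁻¹) ^ 4 := by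
        have h := mul_le_mul hA hB (norm_nonneg e) (by positivity)
        have h4 : (0 : ℝ) ≤ (‖y‖⁻¹) ^ 4 := by positivity
        exact mul_le_mul_of_nonneg_right (mul_le_mul_of_nonneg_left h (by norm_num)) h4
    _ = 12 * ⟪e, y⟫ * ‖y‖⁻¹ ^ 6 * ‖cross e y‖ := by ring

/-- The cone is non-empty: for `e ≠ 0` it contains `e + f` for any `f ⊥ e` with `‖f‖ = ‖e‖`, and such
an `f` exists in `ℝ³`. -/
theorem stokesletCone_nonempty {e : E3} (he : e ≠ 0) :
    ∃ y : E3, y ≠ 0 ∧ (‖e‖ * ‖y‖ < 2 * ⟪e, y⟫ ∧ ‖e‖ * ‖y‖ < 2 * ‖cross e y‖) := by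
  -- a non-zero vector orthogonal to `e`
  haveI : Fact (Module.finrank ℝ E3 = 2 + 1) := ⟨by simp⟩
  have hfin : Module.finrank ℝ (ℝ ∙ e)ᗮ = 2 := Submodule.finrank_orthogonal_span_singleton he
  obtain ⟨w, hw⟩ : ∃ w : (ℝ ∙ e)ᗮ, w ≠ 0 := by
    have : 0 < Module.finrank ℝ (ℝ ∙ e)ᗮ := by rw [hfin]; norm_num
    exact Module.finrank_pos_iff_exists_ne_zero.mp this
  have hw0 : (w : E3) ≠ 0 := by exact_mod_cast hw
  have hwe : ⟪e, (w : E3)⟫ = 0 :=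
    (Submodule.mem_orthogonal_singleton_iff_inner_right).mp w.2
  set f : E3 := (‖e‖ / ‖(w : E3)‖) • (w : E3) with hf
  have hwn : 0 < ‖(w : E3)‖ := norm_pos_iff.mpr hw0
  have hen : 0 < ‖e‖ := norm_pos_iff.mpr he
  have hfn : ‖f‖ = ‖e‖ := by
    rw [hf, norm_smul, Real.norm_eq_abs, abs_of_pos (div_pos hen hwn), div_mul_cancel₀ _ hwn.ne']
  have hfe : ⟪e, f⟫ = 0 := by rw [hf, inner_smul_right, hwe, mul_zero]
  refine ⟨e + f, ?_, ?_, ?_⟩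
  · intro h0
    have : ⟪e, e + f⟫ = 0 := by rw [h0, inner_zero_right]
    rw [inner_add_right, hfe, add_zero, real_inner_self_eq_norm_sq] at this
    exact he (by simpa using this)
  · -- `‖e‖ √2 ‖e‖ < 2 ‖e‖²`
    have hn : ‖e + f‖ ^ 2 = 2 * ‖e‖ ^ 2 := by
      rw [@norm_add_sq_real, hfe, hfn]; ring
    have hlt : ‖e + f‖ < 2 * ‖e‖ := by
      nlinarith [norm_nonneg (e + f), hen]
    rw [inner_add_right, hfe, add_zero, real_inner_self_eq_norm_sq]
    nlinarith [hlt, hen]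
  · have hcr : cross e (e + f) = cross e f := by
      have h0 : cross e e = 0 := by simp [cross]
      rw [← crossCLM_apply, map_add, crossCLM_apply, crossCLM_apply, h0, zero_add]
    have hang : InnerProductGeometry.angle e f = Real.pi / 2 :=
      (InnerProductGeometry.inner_eq_zero_iff_angle_eq_pi_div_two e f).mp hfe
    have hncr : ‖cross e f‖ = ‖e‖ * ‖e‖ := by
      rw [norm_cross, hang, Real.sin_pi_div_two, mul_one, hfn]
    have hn : ‖e + f‖ ^ 2 = 2 * ‖e‖ ^ 2 := by
      rw [@norm_add_sq_real, hfe, hfn]; ring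
    have hlt : ‖e + f‖ < 2 * ‖e‖ := by
      nlinarith [norm_nonneg (e + f), hen]
    rw [hcr, hncr]
    nlinarith [hlt, hen]

/-! ## Non-integrability of the weighted residual density on the cone -/

/-- Dyadic shells of the cone are dilates of the first one. -/
theorem stokesletCone_shell_eq_smul (e : E3) (ρ : ℝ) (k : ℕ) :
    ({y : E3 | ‖e‖ * ‖y‖ < 2 * ⟪e, y⟫ ∧ ‖e‖ * ‖y‖ < 2 * ‖cross e y‖} ∩
        {y : E3 | (2 : ℝ) ^ k * ρ ≤ ‖y‖ ∧ ‖y‖ < (2 : ℝ) ^ (k + 1) * ρ})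
      = ((2 : ℝ) ^ k) • ({y : E3 | ‖e‖ * ‖y‖ < 2 * ⟪e, y⟫ ∧ ‖e‖ * ‖y‖ < 2 * ‖cross e y‖} ∩
        {y : E3 | ρ ≤ ‖y‖ ∧ ‖y‖ < 2 * ρ}) := by
  have h2k : (0 : ℝ) < (2 : ℝ) ^ k := by positivity
  ext y
  rw [Set.mem_smul_set_iff_inv_smul_mem₀ h2k.ne', mem_inter_iff, mem_inter_iff,
    smul_mem_stokesletCone_iff e (inv_pos.mpr h2k)]
  simp only [mem_setOf_eq, norm_smul, Real.norm_eq_abs, abs_of_pos (inv_pos.mpr h2k)]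
  rw [pow_succ]
  constructor
  · rintro ⟨hS, hlo, hhi⟩
    refine ⟨hS, ?_, ?_⟩
    · rw [le_inv_mul_iff₀ h2k]; linarith
    · rw [inv_mul_lt_iff₀ h2k]; linarith
  · rintro ⟨hS, hlo, hhi⟩
    refine ⟨hS, ?_, ?_⟩
    · rw [le_inv_mul_iff₀ h2k] at hlo; linarith
    · rw [inv_mul_lt_iff₀ h2k] at hhi; linarith

/-- ★★ **STOKESLET-TAIL OBSTRUCTION.** If a field `U : ℝ³ → ℝ³` coincides with a Stokeslet `U_e`,
`e ≠ 0`, outside some ball, then its registered residual density `(1+‖y‖)⁵‖g(y)‖²` is NOT integrable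
(on the cone `30° < ∠(e,y) < 60°` it is `≥ 9‖e‖⁴/‖y‖³`, and the dyadic shells of the cone all carry
the same mass).  In particular such a `U` is never a witness of `ForcedTsaiModulusLE M δ`
(`not_integrable` clause), whatever its core: the exact Type-I (Stokeslet) tail of the linear floor
mode is admissible in the registered currency at LINEAR order only (DATUM B-2k §3). -/
theorem not_integrable_residual_of_stokesletTail {U : E3 → E3} {e : E3} (he : e ≠ 0) {R : ℝ}
    (hU : ∀ y : E3, R < ‖y‖ →
      U y = (‖y‖ ^ 2) ^ (-(1 : ℝ) / 2) • e + ((‖y‖ ^ 2) ^ (-(3 : ℝ) / 2) * ⟪e, y⟫) • y) :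
    ¬ Integrable (fun y : E3 => (1 + ‖y‖) ^ 5 * ‖lerayVorticityResidual U y‖ ^ 2) := by
  intro hint
  -- notation
  set S : Set E3 := {y : E3 | ‖e‖ * ‖y‖ < 2 * ⟪e, y⟫ ∧ ‖e‖ * ‖y‖ < 2 * ‖cross e y‖} with hS
  set F : E3 → ℝ := fun y => (1 + ‖y‖) ^ 5 * ‖lerayVorticityResidual U y‖ ^ 2 with hF
  set ρ : ℝ := max R 1 + 1 with hρdef
  have hρR : R < ρ := by rw [hρdef]; linarith [le_max_left R 1]
  have hρ1 : 1 ≤ ρ := by rw [hρdef]; linarith [le_max_right R 1]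
  have hρ : 0 < ρ := by linarith
  set A : ℕ → Set E3 := fun k => S ∩ {y : E3 | (2 : ℝ) ^ k * ρ ≤ ‖y‖ ∧ ‖y‖ < (2 : ℝ) ^ (k + 1) * ρ}
    with hA
  -- (1) the residual of `U` agrees with the Stokeslet residual outside the ball
  have hres : ∀ y : E3, R < ‖y‖ → lerayVorticityResidual U y = lerayVorticityResidual
      (fun z : E3 => (‖z‖ ^ 2) ^ (-(1 : ℝ) / 2) • e + ((‖z‖ ^ 2) ^ (-(3 : ℝ) / 2) * ⟪e, z⟫) • z) y := by
    intro y hy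
    apply lerayVorticityResidual_congr
    have hopen : IsOpen {z : E3 | R < ‖z‖} := isOpen_lt continuous_const continuous_norm
    filter_upwards [hopen.mem_nhds hy] with z hz using hU z hz
  -- (2) pointwise lower bound on the shells: F ≥ 9‖e‖⁴ / (2^{k+1} ρ)^3 on A k
  have hlow : ∀ k : ℕ, ∀ y ∈ A k, 9 * ‖e‖ ^ 4 * (((2 : ℝ) ^ (k + 1) * ρ)⁻¹) ^ 3 ≤ F y := by
    intro k y hy
    obtain ⟨hyS, hlo, hhi⟩ := hy
    have h2k : (1 : ℝ) ≤ (2 : ℝ) ^ k := one_le_pow₀ (by norm_num)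
    have hy1 : 1 ≤ ‖y‖ := le_trans (by nlinarith) hlo
    have hy0 : y ≠ 0 := by
      intro h; rw [h, norm_zero] at hy1; linarith
    have hyR : R < ‖y‖ := lt_of_lt_of_le (by nlinarith) hlo
    have hr : 0 < ‖y‖ := by linarith
    have hg := norm_lerayVorticityResidual_stokeslet_ge e hy0 hyS
    rw [← hres y hyR] at hg
    have hg2 : (3 * ‖e‖ ^ 2 * (‖y‖⁻¹) ^ 4) ^ 2 ≤ ‖lerayVorticityResidual U y‖ ^ 2 :=
      pow_le_pow_left₀ (by positivity) hg 2
    have h5 : ‖y‖ ^ 5 ≤ (1 + ‖y‖) ^ 5 := pow_le_pow_left₀ hr.le (by linarith) 5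
    have hinv : ‖y‖⁻¹ ≤ 1 := inv_le_one_of_one_le₀ hy1
    have hyhi : (((2 : ℝ) ^ (k + 1) * ρ)⁻¹) ≤ ‖y‖⁻¹ := by
      rw [inv_le_inv₀ (by positivity) hr]; exact hhi.le
    calc 9 * ‖e‖ ^ 4 * (((2 : ℝ) ^ (k + 1) * ρ)⁻¹) ^ 3
        ≤ 9 * ‖e‖ ^ 4 * (‖y‖⁻¹) ^ 3 := by gcongr
      _ = ‖y‖ ^ 5 * (3 * ‖e‖ ^ 2 * (‖y‖⁻¹) ^ 4) ^ 2 := by field_simp; ring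
      _ ≤ (1 + ‖y‖) ^ 5 * ‖lerayVorticityResidual U y‖ ^ 2 :=
          mul_le_mul h5 hg2 (by positivity) (by positivity)
  -- (3) the shells are measurable, pairwise disjoint, and `A k = 2^k • A 0`
  have hSopen : IsOpen S := isOpen_stokesletCone e
  have hAmeas : ∀ k, MeasurableSet (A k) := by
    intro k
    refine hSopen.measurableSet.inter ?_
    exact (measurableSet_le measurable_const measurable_norm).inter
      (measurableSet_lt measurable_norm measurable_const)
  have hAdisj : Pairwise (Function.onFun Disjoint A) := by
    intro i j hij
    rw [Function.onFun, Set.disjoint_left]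
    rintro y ⟨-, hi1, hi2⟩ ⟨-, hj1, hj2⟩
    rcases lt_or_gt_of_ne hij with h | h
    · have : (2 : ℝ) ^ (i + 1) * ρ ≤ (2 : ℝ) ^ j * ρ := by
        gcongr
        · norm_num
        · omega
      linarith
    · have : (2 : ℝ) ^ (j + 1) * ρ ≤ (2 : ℝ) ^ i * ρ := by
        gcongr
        · norm_num
        · omega
      linarith
  have hA0 : A 0 = S ∩ {y : E3 | ρ ≤ ‖y‖ ∧ ‖y‖ < 2 * ρ} := by
    ext y
    simp only [hA, mem_inter_iff, mem_setOf_eq, pow_zero, one_mul, zero_add, pow_one]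
  have hAk : ∀ k, volume (A k) = ENNReal.ofReal ((8 : ℝ) ^ k) * volume (A 0) := by
    intro k
    have h := stokesletCone_shell_eq_smul e ρ k
    rw [← hS] at h
    have h8 : |((2 : ℝ) ^ k) ^ Module.finrank ℝ E3| = (8 : ℝ) ^ k := by
      rw [finrank_euclideanSpace_fin, abs_of_pos (by positivity), ← pow_mul, mul_comm, pow_mul]
      norm_num
    rw [hA0, show A k = S ∩ {y : E3 | (2 : ℝ) ^ k * ρ ≤ ‖y‖ ∧ ‖y‖ < (2 : ℝ) ^ (k + 1) * ρ} from rfl,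
      h, Measure.addHaar_smul, h8]
  -- (4) the first shell has positive measure (it contains an open non-empty set)
  have hA0pos : 0 < volume (A 0) := by
    obtain ⟨y₀, hy₀0, hy₀S⟩ := stokesletCone_nonempty he
    have hn0 : 0 < ‖y₀‖ := norm_pos_iff.mpr hy₀0
    set t : ℝ := (3 * ρ / 2) / ‖y₀‖ with ht
    have htpos : 0 < t := by positivity
    have hy₁S : t • y₀ ∈ S := (smul_mem_stokesletCone_iff e htpos y₀).mpr hy₀S
    have hy₁n : ‖t • y₀‖ = 3 * ρ / 2 := by
      rw [norm_smul, Real.norm_eq_abs, abs_of_pos htpos, ht, div_mul_cancel₀ _ hn0.ne']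
    have hO : IsOpen (S ∩ {y : E3 | ρ < ‖y‖ ∧ ‖y‖ < 2 * ρ}) :=
      hSopen.inter ((isOpen_lt continuous_const continuous_norm).inter
        (isOpen_lt continuous_norm continuous_const))
    have hsub : S ∩ {y : E3 | ρ < ‖y‖ ∧ ‖y‖ < 2 * ρ} ⊆ A 0 := by
      rintro y ⟨hyS, h1, h2⟩
      refine ⟨hyS, ?_, ?_⟩
      · simp only [pow_zero, one_mul]; exact h1.le
      · simpa [zero_add, pow_one] using h2
    have hne : (S ∩ {y : E3 | ρ < ‖y‖ ∧ ‖y‖ < 2 * ρ}).Nonempty :=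
      ⟨t • y₀, hy₁S, by rw [mem_setOf_eq, hy₁n]; constructor <;> linarith⟩
    exact lt_of_lt_of_le (hO.measure_pos volume hne) (measure_mono hsub)
  -- (5) every shell carries lintegral mass ≥ a := ofReal(9‖e‖⁴/(8ρ³)) · vol(A 0)
  set a : ENNReal := ENNReal.ofReal (9 * ‖e‖ ^ 4 * (8 * ρ ^ 3)⁻¹) * volume (A 0) with ha
  have hapos : 0 < a := by
    have : 0 < 9 * ‖e‖ ^ 4 * (8 * ρ ^ 3)⁻¹ := by
      have := norm_pos_iff.mpr he; positivity
    exact ENNReal.mul_pos (ENNReal.ofReal_pos.mpr this).ne' hA0pos.ne'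
  have hshell : ∀ k, a ≤ ∫⁻ y in A k, ENNReal.ofReal (F y) := by
    intro k
    have h8 : ((2 : ℝ) ^ (k + 1)) ^ 3 = 8 * 8 ^ k := by
      rw [← pow_mul, mul_comm, pow_mul, pow_succ, mul_comm]
      norm_num
    calc a = ENNReal.ofReal (9 * ‖e‖ ^ 4 * (((2 : ℝ) ^ (k + 1) * ρ)⁻¹) ^ 3) * volume (A k) := by
          rw [ha, hAk k, ← mul_assoc, ← ENNReal.ofReal_mul (by positivity)]
          congr 2
          rw [inv_pow, mul_pow, h8]
          field_simp
      _ = ∫⁻ y in A k, ENNReal.ofReal (9 * ‖e‖ ^ 4 * (((2 : ℝ) ^ (k + 1) * ρ)⁻¹) ^ 3) := by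
          rw [setLIntegral_const]
      _ ≤ ∫⁻ y in A k, ENNReal.ofReal (F y) :=
          setLIntegral_mono' (hAmeas k) fun y hy => ENNReal.ofReal_le_ofReal (hlow k y hy)
  -- (6) summing N shells gives N·a ≤ ∫⁻ F < ∞ for every N: contradiction
  have hfin : ∫⁻ y, ENNReal.ofReal (F y) < ⊤ := hint.lintegral_lt_top
  have hNa : ∀ N : ℕ, (N : ENNReal) * a ≤ ∫⁻ y, ENNReal.ofReal (F y) := by
    intro N
    calc (N : ENNReal) * a = ∑ k ∈ Finset.range N, a := by
          rw [Finset.sum_const, Finset.card_range, nsmul_eq_mul]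
      _ ≤ ∑ k ∈ Finset.range N, ∫⁻ y in A k, ENNReal.ofReal (F y) :=
          Finset.sum_le_sum fun k _ => hshell k
      _ = ∫⁻ y in ⋃ k ∈ Finset.range N, A k, ENNReal.ofReal (F y) := by
          rw [lintegral_biUnion_finset (fun i _ j _ hij => hAdisj hij) (fun k _ => hAmeas k)]
      _ ≤ ∫⁻ y, ENNReal.ofReal (F y) := by
          rw [← setLIntegral_univ (μ := volume) (fun y => ENNReal.ofReal (F y))]
          exact lintegral_mono_set (subset_univ _)
  -- pick N with N·a > ∫⁻ F
  obtain ⟨N, hN⟩ := ENNReal.exists_nat_mul_gt hapos.ne' hfin.ne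
  exact absurd (lt_of_lt_of_le hN (hNa N)) (lt_irrefl _)

/-- COROLLARY (the typed statement): a field with an exact Stokeslet tail is never a witness of
`ForcedTsaiModulusLE M δ` — the registered currency's integrability clause fails. -/
theorem not_forcedTsaiWitness_of_stokesletTail {U : E3 → E3} {e : E3} (he : e ≠ 0) {R : ℝ}
    (hU : ∀ y : E3, R < ‖y‖ →
      U y = (‖y‖ ^ 2) ^ (-(1 : ℝ) / 2) • e + ((‖y‖ ^ 2) ^ (-(3 : ℝ) / 2) * ⟪e, y⟫) • y)
    (M δ : ℝ) :
    ¬ (ContDiff ℝ ((⊤ : ℕ∞) : WithTop ℕ∞) U ∧ VectorCalculus.IsDivFree U ∧ M ≤ lerayLevel U ∧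
        Integrable (fun y => (1 + ‖y‖) ^ 5 * ‖lerayVorticityResidual U y‖ ^ 2) ∧
        lerayResidualNorm U ≤ δ) :=
  fun h => not_integrable_residual_of_stokesletTail he hU h.2.2.2.1

end Summit.NavierStokesRegularity.NavierStokesRegularity.Cruxes.ScarEnvelopeTypeI.ForcedTsai

end
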